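import Literature.AlgebraicGeometry.ShimuraVarieties.UnitaryBallHolomorphicLift
import HarnessLib

/-!
# The holomorphic lift of a class along a Hecke translation is the translated lift

Topic `AlgebraicGeometry/ShimuraVarieties`; namespace
`Literature.AlgebraicGeometry.ShimuraVarieties.UnitaryBallUniformisationDatum` (continues
`UnitaryBallHolomorphicLift`, whose `classLift_pull` is the case `g = 1` of the main theorem here).
Reproduction (kernel): theorems only, no records, no new hypotheses beyond those of the inputs joined.

Let `X`, `X'` be compact ball quotient surfaces with uniformization data `D`, `D'`
(`UnitaryBallUniformisationDatum 2`), read in Hodge models `A`, `A'`, and let `f : X' ⟶ X` be a morphism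
INTERTWINING THE UNIFORMIZATIONS UP TO AN ISOMETRY `g ∈ U(H^{τ₁}) = D.realPoints`:
`f(ℂ) (unif' v) = unif (g v)` on the negative cone (`UnitaryBallHeckeTranslation`: the Hecke translation
`[v] ↦ [γ v]` of a rational isometry `γ`, `g = γ^{τ₁}`; the level covering is `g = 1`).  Fix a Sylvester frame
`𝔣` of `D` and give `D'` the SAME frame matrix (`𝔣'.t = 𝔣.t`; possible since the two data have the same complex
Gram matrix), and let `ĝ := D.frameIso 𝔣 g = T⁻¹ g T ∈ U(2,1)` be `g` read on the Poincaré ball `𝔹²`.  Then: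

* `unif_mulVec_coneLift` — `unif (g · T(z,1)) = ballUnifMap (ĝ • z)` (equivariance of the cone chart,
  `coneChart_smul`);
* `anMap_modelUnif_mulVec` — **`f^an ∘ ψ' = ψ ∘ ĝ` on the ball** (`ψ = D.modelUnif A 𝔣`, `ψ' = D'.modelUnif A' 𝔣'`);
* `mfderiv_anMap_comp_unifDeriv_mulVec` — the chain rule `d(f^an)_{ψ' z} ∘ dψ'_z = dψ_{ĝ z} ∘ J(ĝ, z)`;
* `formPullback₁_pullback_anMap_mulVec` — for a `ℂ`-linear `1`-form `α` on `X^an`,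
  `formPullback₁' ((f^an)^* α) (z) = J(ĝ, z)ᵀ · formPullback₁ α (ĝ z)`: the pull-back of `(f^an)^*α` to the ball
  through `ψ'` is the TRANSLATE `ĝ^*` (`BallForms.factorPullback BallForms.cotangentCocycle ĝ`) of the pull-back
  of `α` through `ψ` (Borel §5.14: `(γ^* F)(z) = J(γ, z)ᵀ F(γ z)`);
* **`classLift_pull_mulVec`** — for `ω ∈ F¹H¹(X)`, **the holomorphic lift of `f^* ω` (computed on `X'`) is
  `ĝ^*(lift ω) : z ↦ J(ĝ, z)ᵀ · (lift ω)(ĝ z)`**: the holomorphic representative of `f^*ω` is `(f^an)^* α`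
  (GAGA: `f^an` is holomorphic; naturality of the standard de Rham family and of `Θ`; uniqueness of holomorphic
  representatives, Voisin I Cor. 7.6) — verbatim the argument of `classLift_pull` — and the previous item
  (the right-hand side is `BallForms.factorPullback BallForms.cotangentCocycle ĝ (lift ω)` of `UnitaryBallClassMap`,
  `factorPullback_cotangentCocycle_apply`, not imported here to keep the cone light).

This is the geometric half of the action of Hecke translations on holomorphic one-forms of the tower of ball
quotients (Shimura 1971 §7.2–7.3; Bergeron–Millson–Moeglin, Introduction §1.1): on lifts to `𝔹²`,
`(T_γ)^*` IS the factor pull-back by `γ`.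

## References

* A. Borel, *Automorphic forms on `SL₂(ℝ)`*, Cambridge Tracts in Math. 130 (1997), §5.13–5.14.
* G. Shimura, *Introduction to the arithmetic theory of automorphic functions* (1971), §7.2–7.3.
* C. Voisin, *Hodge Theory and Complex Algebraic Geometry I* (2002), §2.2.1, §7.1.1 Cor. 7.6, §7.3.2.
* J.-P. Serre, GAGA, Ann. Inst. Fourier 6 (1956), §2 n°5 (fonctorialité).
* N. Bergeron, J. Millson, C. Moeglin, Acta Math. 216 (2016), Introduction §1.1, Part 2 §1.3.

## Provenance

Reproduction (Literature) for the Hodge-ladder cell pub-hodgecm2 (COR-CM, stage 2), seat b06 (gen 19), lane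
WEDGE-PROOF (in-tree proof of the displayed input B01-H `HeckeWedge10` of junction B01): the dictionary step
«`classLift (T_γ^* ω) = γ^*(classLift ω)`».  Every declaration is kernel-checked; no new records.
-/

noncomputable section

open Matrix MulAction Function Set Filter
open scoped Manifold ContDiff Topology TensorProduct
open CategoryTheory
open Literature.Geometry.ComplexHyperbolic
open Literature.Geometry.ComplexHyperbolic.BallModel (U21 Ball Jac nsq actVec)
open Literature.Geometry.Kaehler (MForm IsHolomorphicInCharts holFormsInCharts isOfType_of_mem
  isHolomorphicInCharts_of_mem isSmoothForm_of_mem)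
open Literature.NumberTheory.Transcendental
open Literature.AlgebraicTopology.SingularHomology
open Literature.AlgebraicGeometry.HodgeTheory
open Literature.AlgebraicGeometry.Motives (bettiCohomology ofRatClassBaseChange)

namespace Literature.AlgebraicGeometry.ShimuraVarieties

namespace UnitaryBallUniformisationDatum

variable {X : Motives.SchemeOver ℂ} (D : UnitaryBallUniformisationDatum 2 X)

/-! ### The uniformization and an isometry of the cone -/

section Cone

variable (𝔣 : D.SylvesterFrame)

/-- **`unif (g · T(z,1)) = ballUnifMap (ĝ • z)`** for `g ∈ U(H^{τ₁})`, `ĝ = T⁻¹ g T`: the cone chart is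
equivariant (`coneChart_smul`) and `unif` factors through it. [cite: BergeronMillsonMoeglin2016Balls, Part 2 §1.3] -/
theorem unif_mulVec_coneLift {g : GL (Fin 3) ℂ} (hg : g ∈ D.realPoints) (z : Ball) :
    D.unif ((g : Matrix (Fin 3) (Fin 3) ℂ) *ᵥ (D.coneLift 𝔣 z : Fin 3 → ℂ)) =
      D.ballUnifMap 𝔣 (D.frameIso 𝔣 ⟨g, hg⟩ • z) := by
  have h : (g : Matrix (Fin 3) (Fin 3) ℂ) *ᵥ (D.coneLift 𝔣 z : Fin 3 → ℂ) =
      (((⟨g, hg⟩ : D.realPoints) • D.coneLift 𝔣 z : D.cone) : Fin 3 → ℂ) := rfl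
  rw [h, D.unif_eq_ballUnifMap_coneChart 𝔣, D.coneChart_smul 𝔣, D.coneChart_coneLift]

end Cone

/-! ### Two ball quotients, a morphism intertwining the uniformizations up to an isometry -/

section Translate

variable {X' : Motives.SchemeOver ℂ} (D' : UnitaryBallUniformisationDatum 2 X') (A : HodgeModel 2 X)
  (A' : HodgeModel 2 X') (f : X' ⟶ X) (𝔣 : D.SylvesterFrame) (𝔣' : D'.SylvesterFrame)

/-- The frame sections agree when the frame matrices do: `T'(z,1) = T(z,1)`.
[cite: BergeronMillsonMoeglin2016Balls, Part 2 §1.1] -/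
theorem coe_coneLift_eq_of_t_eq (hT : 𝔣'.t = 𝔣.t) (z : Ball) :
    ((D'.coneLift 𝔣' z : D'.cone) : Fin 3 → ℂ) = (D.coneLift 𝔣 z : Fin 3 → ℂ) := by
  change 𝔣'.t *ᵥ BallModel.lift z = 𝔣.t *ᵥ BallModel.lift z
  rw [hT]

/-- **`f^an ∘ ψ' = ψ ∘ ĝ` on the ball** when `f(ℂ) (unif' v) = unif (g v)` on the cone, `g ∈ U(H^{τ₁})`, and the
frames agree; `ĝ = T⁻¹ g T`. [cite: Shimura1973, §7.2–7.3] [cite: SerreGAGA1956, §2 n°5 (fonctorialité)] -/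
theorem anMap_modelUnif_mulVec (hT : 𝔣'.t = 𝔣.t) {g : GL (Fin 3) ℂ} (hg : g ∈ D.realPoints)
    (hf : ∀ v ∈ D'.cone, Motives.AlgPoints.map f (D'.unif v) = D.unif ((g : Matrix (Fin 3) (Fin 3) ℂ) *ᵥ v))
    (z : Ball) :
    HodgeModel.anMap A A' f (D'.modelUnif A' 𝔣' z.1) = D.modelUnif A 𝔣 (D.frameIso 𝔣 ⟨g, hg⟩ • z).1 := by
  change A.isAnalytification.homeomorph.symm (Motives.AlgPoints.map f
      (A'.toComplexPoints (D'.modelUnif A' 𝔣' z.1))) = _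
  rw [toComplexPoints_modelUnif, ballUnifMap_apply, hf _ (D'.coneLift 𝔣' z).2, modelUnif_coe,
    D.coe_coneLift_eq_of_t_eq D' 𝔣 𝔣' hT z, D.unif_mulVec_coneLift 𝔣 hg z]

/-- Near a ball point, `f^an ∘ ψ' = ψ ∘ (ĝ ·)` with the action written as the map `actVec ĝ` of `ℂ²` (the ball
is open). [cite: Shimura1973, §7.2–7.3] [cite: SerreGAGA1956, §2 n°5 (fonctorialité)] -/
theorem anMap_comp_modelUnif_eventuallyEq_mulVec (hT : 𝔣'.t = 𝔣.t) {g : GL (Fin 3) ℂ} (hg : g ∈ D.realPoints)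
    (hf : ∀ v ∈ D'.cone, Motives.AlgPoints.map f (D'.unif v) = D.unif ((g : Matrix (Fin 3) (Fin 3) ℂ) *ᵥ v))
    (z : Ball) :
    (HodgeModel.anMap A A' f ∘ D'.modelUnif A' 𝔣') =ᶠ[𝓝 z.1]
      (D.modelUnif A 𝔣 ∘ actVec (D.frameIso 𝔣 ⟨g, hg⟩)) := by
  filter_upwards [BallForms.isOpen_ballSet.mem_nhds (BallForms.coe_mem_ballSet z)] with w hw
  change HodgeModel.anMap A A' f (D'.modelUnif A' 𝔣' (⟨w, hw⟩ : Ball).1) =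
    D.modelUnif A 𝔣 (actVec (D.frameIso 𝔣 ⟨g, hg⟩) (⟨w, hw⟩ : Ball).1)
  rw [BallModel.actVec_eq]
  exact D.anMap_modelUnif_mulVec D' A A' f 𝔣 𝔣' hT hg hf ⟨w, hw⟩

/-- **Chain rule `d(f^an)_{ψ' z} ∘ dψ'_z = dψ_{ĝ z} ∘ J(ĝ, z)`** (`f^an` holomorphic by GAGA, `ψ`, `ψ'` holomorphic
on the ball, `actVec ĝ` with derivative `Jac ĝ z`). [cite: VoisinHodgeI2002, §2.2.1]
[cite: SerreGAGA1956, §2 n°5 (fonctorialité)] -/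
theorem mfderiv_anMap_comp_unifDeriv_mulVec (hX : Motives.IsSmoothProjective 2 X)
    (hX' : Motives.IsSmoothProjective 2 X') (hT : 𝔣'.t = 𝔣.t) {g : GL (Fin 3) ℂ} (hg : g ∈ D.realPoints)
    (hf : ∀ v ∈ D'.cone, Motives.AlgPoints.map f (D'.unif v) = D.unif ((g : Matrix (Fin 3) (Fin 3) ℂ) *ᵥ v))
    (z : Ball) :
    (mfderiv 𝓘(ℝ, A'.model) 𝓘(ℝ, A.model) (HodgeModel.anMap A A' f) (D'.modelUnif A' 𝔣' z.1)).comp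
        (D'.unifDeriv A' 𝔣' z.1) =
      (D.unifDeriv A 𝔣 (D.frameIso 𝔣 ⟨g, hg⟩ • z).1).comp (jacCLM (D.frameIso 𝔣 ⟨g, hg⟩) z) := by
  -- the derivative of `f^an ∘ ψ'` at `z`
  have h1 : HasMFDerivAt 𝓘(ℝ, Fin 2 → ℂ) 𝓘(ℝ, A.model) (HodgeModel.anMap A A' f ∘ D'.modelUnif A' 𝔣') z.1
      ((mfderiv 𝓘(ℝ, A'.model) 𝓘(ℝ, A.model) (HodgeModel.anMap A A' f) (D'.modelUnif A' 𝔣' z.1)).comp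
        (D'.unifDeriv A' 𝔣' z.1)) :=
    HasMFDerivAt.comp z.1
      ((HodgeModel.mdifferentiable_anMap A A' f hX' hX _).real_of_complex.hasMFDerivAt)
      (D'.mdifferentiableAt_modelUnif A' 𝔣' z).real_of_complex.hasMFDerivAt
  -- the derivative of `ψ ∘ actVec ĝ` at `z`
  have h2 : HasMFDerivAt 𝓘(ℝ, Fin 2 → ℂ) 𝓘(ℝ, A.model) (D.modelUnif A 𝔣 ∘ actVec (D.frameIso 𝔣 ⟨g, hg⟩)) z.1
      ((D.unifDeriv A 𝔣 (D.frameIso 𝔣 ⟨g, hg⟩ • z).1).comp (jacCLM (D.frameIso 𝔣 ⟨g, hg⟩) z)) := by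
    have hψ : HasMFDerivAt 𝓘(ℝ, Fin 2 → ℂ) 𝓘(ℝ, A.model) (D.modelUnif A 𝔣)
        (actVec (D.frameIso 𝔣 ⟨g, hg⟩) z.1) (D.unifDeriv A 𝔣 (D.frameIso 𝔣 ⟨g, hg⟩ • z).1) := by
      rw [BallModel.actVec_eq]
      exact (D.mdifferentiableAt_modelUnif A 𝔣 _).real_of_complex.hasMFDerivAt
    exact hψ.comp z.1 (hasMFDerivAt_actVec (D.frameIso 𝔣 ⟨g, hg⟩) z)
  have e1 := (h1.congr_of_eventuallyEq
    (D.anMap_comp_modelUnif_eventuallyEq_mulVec D' A A' f 𝔣 𝔣' hT hg hf z).symm).mfderiv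
  exact e1.symm.trans h2.mfderiv

/-- **The pull-back of `(f^an)^* α` to the ball is the translate by `ĝ` of the pull-back of `α`**:
`formPullback₁' ((f^an)^* α) (z) = J(ĝ, z)ᵀ · formPullback₁ α (ĝ z)` for a `ℂ`-linear `1`-form `α` on `X^an`
(chain rule and `ℂ`-linearity of `dψ` and of `α`). [cite: Borel1997, §5.14] [cite: VoisinHodgeI2002, §2.2.1] -/
theorem formPullback₁_pullback_anMap_mulVec (hX : Motives.IsSmoothProjective 2 X)
    (hX' : Motives.IsSmoothProjective 2 X') (hT : 𝔣'.t = 𝔣.t) {g : GL (Fin 3) ℂ} (hg : g ∈ D.realPoints)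
    (hf : ∀ v ∈ D'.cone, Motives.AlgPoints.map f (D'.unif v) = D.unif ((g : Matrix (Fin 3) (Fin 3) ℂ) *ᵥ v))
    {α : MForm 𝓘(ℝ, A.model) A.carrier ℂ 1} (hα : IsComplexLinearForm α) (z : Ball) :
    D'.formPullback₁ A' 𝔣' (α.pullback 𝓘(ℝ, A'.model) (HodgeModel.anMap A A' f)) z =
      (Jac (D.frameIso 𝔣 ⟨g, hg⟩) z)ᵀ *ᵥ D.formPullback₁ A 𝔣 α (D.frameIso 𝔣 ⟨g, hg⟩ • z) := by
  have key : ∀ {x y : A.carrier}, x = y → ∀ u : A.model, α x (fun _ ↦ u) = α y (fun _ ↦ u) := by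
    intro x y h u
    subst h
    rfl
  funext i
  rw [formPullback₁_apply, MForm.pullback_apply]
  have hcomp : ∀ w : Fin 2 → ℂ,
      (mfderiv 𝓘(ℝ, A'.model) 𝓘(ℝ, A.model) (HodgeModel.anMap A A' f) (D'.modelUnif A' 𝔣' z.1))
          (D'.unifDeriv A' 𝔣' z.1 w) =
        D.unifDeriv A 𝔣 (D.frameIso 𝔣 ⟨g, hg⟩ • z).1 (Jac (D.frameIso 𝔣 ⟨g, hg⟩) z *ᵥ w) := fun w ↦ by
    have h := congrArg (fun φ : (Fin 2 → ℂ) →L[ℝ] A.model ↦ φ w)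
      (D.mfderiv_anMap_comp_unifDeriv_mulVec D' A A' f 𝔣 𝔣' hX hX' hT hg hf z)
    simp only [ContinuousLinearMap.comp_apply, jacCLM_apply] at h
    exact h
  have hcomp' : (fun _ : Fin 1 ↦ (mfderiv 𝓘(ℝ, A'.model) 𝓘(ℝ, A.model) (HodgeModel.anMap A A' f)
      (D'.modelUnif A' 𝔣' z.1)) (D'.unifDeriv A' 𝔣' z.1 (Pi.single i 1))) =
      fun _ : Fin 1 ↦ D.unifDeriv A 𝔣 (D.frameIso 𝔣 ⟨g, hg⟩ • z).1
        (Jac (D.frameIso 𝔣 ⟨g, hg⟩) z *ᵥ Pi.single i 1) :=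
    funext fun _ ↦ hcomp _
  rw [hcomp', key (D.anMap_modelUnif_mulVec D' A A' f 𝔣 𝔣' hT hg hf z)]
  simp only [jac_mulVec_single, map_add, unifDeriv_smul]
  rw [mform₁_apply_add, mform₁_apply_smul hα, mform₁_apply_smul hα]
  simp [Matrix.mulVec, dotProduct, Fin.sum_univ_two, formPullback₁_apply]

end Translate

/-! ### The holomorphic lift of a class along a Hecke translation -/

section ClassLift

/-- **(translate) Compatibility of the lift with Hecke translations.** Let `f : X' ⟶ X` be a morphism of ball
quotient surfaces with `f(ℂ) (unif' v) = unif (g v)` on the cone for an isometry `g ∈ U(H^{τ₁})`, and give `D'`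
the frame matrix of `𝔣`. Then for `ω ∈ F¹H¹(X)` the lift of `f^* ω` (computed on `X'`) is the translate of the
lift of `ω` by `ĝ = T⁻¹ g T ∈ U(2,1)`: `lift' (f^*ω) (z) = J(ĝ, z)ᵀ · (lift ω)(ĝ z)`.  The holomorphic
representative of `f^*ω` is `(f^an)^* α` (GAGA: `f^an` is holomorphic, so `(f^an)^*α` is a closed `(1,0)`-form,
i.e. holomorphic, with class `(f^an)^*[α] = Θ'(f^*ω)` by naturality of the standard de Rham family and of `Θ`;
uniqueness of holomorphic representatives, Voisin I Cor. 7.6), and `f^an ∘ ψ' = ψ ∘ ĝ` on the ball.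
[cite: Shimura1973, §7.2–7.3] [cite: Borel1997, §5.14] [cite: VoisinHodgeI2002, §7.1.1 Cor. 7.6 and §7.3.2]
[cite: SerreGAGA1956, §2 n°5 (fonctorialité)] -/
theorem classLift_pull_mulVec (hHD : exists_isReal_hodgeModel) (𝔣 : D.SylvesterFrame)
    (hI : hodgePQ_independent_of_hodgeModel) {X' : Motives.SchemeOver ℂ}
    (D' : UnitaryBallUniformisationDatum 2 X') (𝔣' : D'.SylvesterFrame) (f : X' ⟶ X) (hT : 𝔣'.t = 𝔣.t)
    {g : GL (Fin 3) ℂ} (hg : g ∈ D.realPoints)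
    (hf : ∀ v ∈ D'.cone, Motives.AlgPoints.map f (D'.unif v) = D.unif ((g : Matrix (Fin 3) (Fin 3) ℂ) *ᵥ v))
    {hX : Motives.IsSmoothProjective 2 X} {c : ℂ ⊗[ℚ] bettiCohomology X 1}
    (hc : c ∈ (BettiUniverse.hodge hHD hX 1).F 1) :
    D'.classLift hHD 𝔣' ((BettiUniverse.pull f 1).baseChange ℂ c) =
      fun z ↦ (Jac (D.frameIso 𝔣 ⟨g, hg⟩) z)ᵀ *ᵥ D.classLift hHD 𝔣 c (D.frameIso 𝔣 ⟨g, hg⟩ • z) := by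
  set hXD := D.isSmoothProjective
  set hXD' := D'.isSmoothProjective
  set A := stdModel hHD hXD with hA
  set A' := stdModel hHD hXD' with hA'
  haveI : CompleteSpace (Fin 2 → ℂ) := FiniteDimensional.complete ℂ (Fin 2 → ℂ)
  have hcl : A.HolFormsClosed 1 := A.holFormsClosed_of_finrank_succ hXD
  have hcl' : A'.HolFormsClosed 1 := A'.holFormsClosed_of_finrank_succ hXD'
  have hcp : c ∈ A.ratPiece hXD 1 1 0 := mem_ratPiece_stdModel_of_mem_hodge_F hHD hI hXD hc
  set α := A.oneFormOfClassSurface hXD c with hαdef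
  -- the analytified morphism and the pulled-back form
  set φ : A'.carrier → A.carrier := HodgeModel.anMap A A' f with hφdef
  have hφ' : MDifferentiable 𝓘(ℂ, Fin 2 → ℂ) 𝓘(ℂ, Fin 2 → ℂ) φ :=
    HodgeModel.mdifferentiable_anMap A A' f hXD' hXD
  have hφ : ContMDiff 𝓘(ℝ, Fin 2 → ℂ) 𝓘(ℝ, Fin 2 → ℂ) ∞ φ := hφ'.contMDiff_real_of_complex
  set β : MForm 𝓘(ℝ, Fin 2 → ℂ) A'.carrier ℂ 1 :=
    (α : MForm 𝓘(ℝ, Fin 2 → ℂ) A.carrier ℂ 1).pullback 𝓘(ℝ, Fin 2 → ℂ) φ with hβdef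
  have hβc : β ∈ cclosedSmoothForms (Fin 2 → ℂ) A'.carrier 1 :=
    pullback_mem_cclosedSmoothForms hφ (hcl α)
  have hβt : IsOfType 1 0 β := (isOfType_of_mem α).pullback hφ'
  have hβh : β ∈ holFormsInCharts (Fin 2 → ℂ) A'.carrier 1 :=
    mem_holFormsInCharts_of_isClosedForm_of_isOfType_one_zero
      ((mem_cclosedSmoothForms_iff β).1 hβc).1 ((mem_cclosedSmoothForms_iff β).1 hβc).2 hβt
  -- its class is `Θ'(f^* c)`
  have hclassβ : A'.holFormClass 1 hcl' ⟨β, hβh⟩ =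
      A'.complexification hXD' 1 ((BettiUniverse.pull f 1).baseChange ℂ c) := by
    rw [HodgeModel.holFormClass_apply]
    have hmk : complexDeRhamCohomology.mk (Fin 2 → ℂ) A'.carrier 1 (A'.holFormsToClosed 1 hcl' ⟨β, hβh⟩) =
        complexDeRhamCohomology.map (Fin 2 → ℂ) hφ 1
          (complexDeRhamCohomology.mk (Fin 2 → ℂ) A.carrier 1 ⟨α, hcl α⟩) := by
      rw [complexDeRhamCohomology.map_mk]
      rfl
    rw [hmk, A'.deRham_isNatural A'.carrier A.carrier φ hφ 1]
    have hΘ : A'.deRham A.carrier 1 (complexDeRhamCohomology.mk (Fin 2 → ℂ) A.carrier 1 ⟨α, hcl α⟩) =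
        A.complexification hXD 1 c := by
      rw [← A.holFormClass_oneFormOfClassSurface_of_mem_ratPiece hXD hcp, HodgeModel.holFormClass_apply]
      rfl
    rw [hΘ, HodgeModel.complexification_apply, HodgeModel.complexification_apply]
    have hnat := HodgeModel.map_anMap_pullback A A' f 1
      (ofRatClassBaseChange (Motives.ComplexPoints X) 1 c)
    rw [map_ofRatClassBaseChange _ 1 (Motives.AlgPoints.mapContinuous (L := ℂ) f)] at hnat
    exact hnat
  -- hence it IS the holomorphic representative of `f^* c`
  have hβeq : (⟨β, hβh⟩ : holFormsInCharts (Fin 2 → ℂ) A'.carrier 1) =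
      A'.oneFormOfClassSurface hXD' ((BettiUniverse.pull f 1).baseChange ℂ c) :=
    A'.eq_oneFormOfClass_of_holFormClass_eq hXD' hcl' hclassβ
  -- and the lifts agree pointwise up to the translate
  rw [classLift_apply, classLift_apply, ← hβeq]
  funext z
  exact D.formPullback₁_pullback_anMap_mulVec D' A A' f 𝔣 𝔣' hXD hXD' hT hg hf
    (isOfType_of_mem α).isComplexLinearForm z

end ClassLift

end UnitaryBallUniformisationDatum

end Literature.AlgebraicGeometry.ShimuraVarieties

end
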